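import Mathlib
import Summits.PneNP.PneNP.Theorems.ConvexRankGatesConvexGateBlindExactLiftingTriangleDegreeTwoSubcube

/-!
# PneNP / ConvexRankGates — `ConvexGateBlind`, line `xor-door-perfect-completeness`:
# asymptotic DEGREE-2 BLINDNESS of the triangle instance — the corollary (lead c5)

Registered sub-goal `triangle_degreeTwo_blind` of crux item stmt-PneNP-10680 (line
`xor-door-perfect-completeness`, open stub `stub_exactLifting : XorDoor.ExactLifting`).

Assembles `…TriangleDegreeTwo.lean` (pointer side: `pairing_bound`), `…TriangleDegreeTwoMoments.lean`
(moment identity) and `…TriangleDegreeTwoSubcube.lean` (line conditions):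

* `term_bound` — for one term `a ⊗ b` with `a` a non-negative degree-2 row function and `b` a non-negative
  interaction-free column function: `4t·Σ_{x,w} a b [mono] ≤ (2t+8)·Σ_{x,w} a b`, i.e. the
  `(a ⊗ b)`-weighted density of mono entries of the triangle matrix is at most `1/2 + 2/t`;
* `triangle_degreeTwo_blind` (registered): if `M_t − εJ = Σ_l a_l ⊗ b_l` EXACTLY with every `a_l` a
  non-negative degree-2 row function and every `b_l` a non-negative interaction-free column function, any
  number of terms, then `ε·(t + 8) ≤ 12` (`t ≥ 1`): summing the term bounds,
  `4t(3−ε)·#mono ≤ (2t+8)((1−ε)·4#mono + 2#mono)`.  So for fixed `ε > 0` such factorisations of the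
  shifted triangle matrix do not exist once `t > 12/ε − 8`, although they exist at `t = 2` (`ε ≤ 3/7`)
  and `t = 3` (`ε ≤ 3/31`) by exact rational LPs (memo `ExactLifting-c5.md` §2) — the first ε-exact
  obstruction in this programme beyond junta classes.  Structural only: the same mono-density bookkeeping
  for GENERAL rank-one terms is the (functional, capped) domination hyperplane bound, so nothing uniform
  in ε about `rk₊₊(M_t)` follows.

No new definitions.
-/

set_option linter.dupNamespace false -- `Summit.PneNP.PneNP.…`: summit = sub-problem (D-0017)

namespace Summit.PneNP.PneNP.Theorems.XorDoor

open scoped BigOperators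
open Finset TriangleInst

noncomputable section

namespace TriDegTwo

variable {t : ℕ}

/-! ## §6 One term, and the corollary -/

/-- `Σ_x a = #tables · α`. -/
theorem sum_a (α : ℝ) (A01 A12 A02 : Fin t → Fin t → ℝ) (a : (Fin 3 → Fin t → ZMod 2) → ℝ)
    (ha : ∀ x, a x = α + quad A01 A12 A02 x) :
    ∑ x, a x = (Fintype.card (Fin 3 → Fin t → ZMod 2) : ℝ) * α := by
  simp only [ha, Finset.sum_add_distrib, sum_quad, add_zero, Finset.sum_const, Finset.card_univ, nsmul_eq_mul]

/-- **One term.** For a non-negative degree-2 row function `a` and a non-negative interaction-free `b`: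
`4t · Σ_{x,w} a(x)b(w)[mono] ≤ (2t + 8) · Σ_{x,w} a(x)b(w)` — the `(a ⊗ b)`-weighted density of mono
entries is at most `1/2 + 2/t`. -/
theorem term_bound (α : ℝ) (A01 A12 A02 : Fin t → Fin t → ℝ) (a : (Fin 3 → Fin t → ZMod 2) → ℝ)
    (ha : ∀ x, a x = α + quad A01 A12 A02 x) (hpos : ∀ x, 0 ≤ a x)
    (b : Fin t × Fin t × Fin t → ℝ) (hbnn : ∀ w, 0 ≤ b w)
    (hb : ∃ f g h : Fin t → Fin t → ℝ, ∀ w, b w = f w.1 w.2.1 + g w.2.1 w.2.2 + h w.1 w.2.2) :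
    4 * (t : ℝ) * ∑ x, ∑ w, a x * b w * monoInd x w ≤ (2 * (t : ℝ) + 8) * ∑ x, ∑ w, a x * b w := by
  set C : ℝ := (Fintype.card (Fin 3 → Fin t → ZMod 2) : ℝ) with hC
  have hCnn : 0 ≤ C := by rw [hC]; exact Nat.cast_nonneg _
  -- the mono side
  have hmono : 4 * ∑ x, ∑ w, a x * b w * monoInd x w = C * (α * ∑ w, b w + ∑ w, b w * Fpair A01 A12 A02 w) := by
    rw [Finset.sum_comm]
    have : ∀ w, ∑ x, a x * b w * monoInd x w = b w * ∑ x, a x * monoInd x w := by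
      intro w; rw [Finset.mul_sum]; refine Finset.sum_congr rfl fun x _ => ?_; ring
    simp only [this]
    rw [Finset.mul_sum]
    have : ∀ w, 4 * (b w * ∑ x, a x * monoInd x w) = C * (α * b w + b w * Fpair A01 A12 A02 w) := by
      intro w
      have := sum_a_mono α A01 A12 A02 a ha w
      linear_combination b w * this
    simp only [this, ← Finset.mul_sum, Finset.sum_add_distrib]
  -- the mass side
  have hmass : ∑ x, ∑ w, a x * b w = C * (α * ∑ w, b w) := by
    have : ∑ x, ∑ w, a x * b w = (∑ x, a x) * ∑ w, b w := by
      rw [Finset.sum_mul]; refine Finset.sum_congr rfl fun x _ => ?_; rw [Finset.mul_sum]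
    rw [this, sum_a α A01 A12 A02 a ha]; ring
  -- the pairing bound
  have hpair := pairing_bound (Fpair A01 A12 A02) (lineCond₀ α A01 A12 A02 a ha hpos)
    (lineCond₁ α A01 A12 A02 a ha hpos) (lineCond₂ α A01 A12 A02 a ha hpos) b hbnn hb
  calc 4 * (t : ℝ) * ∑ x, ∑ w, a x * b w * monoInd x w
      = (t : ℝ) * (4 * ∑ x, ∑ w, a x * b w * monoInd x w) := by ring
    _ = C * ((t : ℝ) * (α * ∑ w, b w) + (t : ℝ) * ∑ w, b w * Fpair A01 A12 A02 w) := by rw [hmono]; ring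
    _ ≤ C * ((t : ℝ) * (α * ∑ w, b w) + ((t : ℝ) + 8) * α * ∑ w, b w) := by gcongr
    _ = (2 * (t : ℝ) + 8) * (C * (α * ∑ w, b w)) := by ring
    _ = (2 * (t : ℝ) + 8) * ∑ x, ∑ w, a x * b w := by rw [hmass]

/-- The number of mono entries per column: `4·Σ_x [mono at w] = #tables`. -/
theorem four_sum_monoInd (w : Fin t × Fin t × Fin t) :
    4 * ∑ x : Fin 3 → Fin t → ZMod 2, monoInd x w = (Fintype.card (Fin 3 → Fin t → ZMod 2) : ℝ) := by
  have h := sum_a_mono (t := t) 1 (fun _ _ => 0) (fun _ _ => 0) (fun _ _ => 0) (fun _ => 1)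
    (fun x => by simp [quad]) w
  simp only [one_mul, Fpair, add_zero] at h
  simpa using h

end TriDegTwo

/-- **Registered sub-goal `triangle_degreeTwo_blind` of stmt-PneNP-10680** (by name): ASYMPTOTIC DEGREE-2
BLINDNESS of the triangle instance.  If the shifted triangle matrix `M_t − εJ` (`M_t[x,(π,ρ,σ)] = 3` if
`x₀(π) = x₁(ρ) = x₂(σ)`, else `1`) is written EXACTLY as `Σ_l a_l(x) b_l(w)` with every `a_l` a
non-negative row function of cross-block Fourier degree `≤ 2` and every `b_l` a non-negative
interaction-free column function, then `ε·(t + 8) ≤ 12` (`t ≥ 1`; any number of terms). -/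
theorem triangle_degreeTwo_blind : ∀ (t : ℕ), 1 ≤ t → ∀ (ε : ℝ) (L : Type) [Fintype L]
    (a : L → (Fin 3 → Fin t → ZMod 2) → ℝ) (b : L → Fin t × Fin t × Fin t → ℝ),
    (∀ l, ∃ (α : ℝ) (A01 A12 A02 : Fin t → Fin t → ℝ), ∀ x, a l x = α + ∑ π, ∑ ρ,
      (A01 π ρ * TriangleInst.sgnR (x 0 π) * TriangleInst.sgnR (x 1 ρ)
        + A12 π ρ * TriangleInst.sgnR (x 1 π) * TriangleInst.sgnR (x 2 ρ)
        + A02 π ρ * TriangleInst.sgnR (x 0 π) * TriangleInst.sgnR (x 2 ρ))) →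
    (∀ l x, 0 ≤ a l x) → (∀ l w, 0 ≤ b l w) →
    (∀ l, ∃ f g h : Fin t → Fin t → ℝ, ∀ w, b l w = f w.1 w.2.1 + g w.2.1 w.2.2 + h w.1 w.2.2) →
    (∀ (x : Fin 3 → Fin t → ZMod 2) (w : Fin t × Fin t × Fin t),
      (if x 0 w.1 = x 1 w.2.1 ∧ x 1 w.2.1 = x 2 w.2.2 then (3 : ℝ) else 1) - ε = ∑ l, a l x * b l w) →
    ε * ((t : ℝ) + 8) ≤ 12 := by
  intro t ht ε L _ a b hdeg hapos hbpos hanova hfact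
  -- per-term bounds, summed
  have hterm : ∀ l, 4 * (t : ℝ) * ∑ x, ∑ w, a l x * b l w * TriDegTwo.monoInd x w ≤
      (2 * (t : ℝ) + 8) * ∑ x, ∑ w, a l x * b l w := by
    intro l
    obtain ⟨α, A01, A12, A02, hl⟩ := hdeg l
    exact TriDegTwo.term_bound α A01 A12 A02 (a l) (fun x => by rw [hl x]; rfl) (hapos l) (b l) (hbpos l) (hanova l)
  have hsum : 4 * (t : ℝ) * ∑ x, ∑ w, (∑ l, a l x * b l w) * TriDegTwo.monoInd x w ≤
      (2 * (t : ℝ) + 8) * ∑ x, ∑ w, ∑ l, a l x * b l w := by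
    have h1 : ∑ x, ∑ w, (∑ l, a l x * b l w) * TriDegTwo.monoInd x w =
        ∑ l, ∑ x, ∑ w, a l x * b l w * TriDegTwo.monoInd x w := by
      symm
      rw [Finset.sum_comm]; refine Finset.sum_congr rfl fun x _ => ?_
      rw [Finset.sum_comm]; refine Finset.sum_congr rfl fun w _ => ?_
      rw [Finset.sum_mul]
    have h2 : ∑ x, ∑ w, ∑ l, a l x * b l w = ∑ l, ∑ x, ∑ w, a l x * b l w := by
      symm
      rw [Finset.sum_comm]; refine Finset.sum_congr rfl fun x _ => ?_
      rw [Finset.sum_comm]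
    rw [h1, h2, Finset.mul_sum, Finset.mul_sum]
    exact Finset.sum_le_sum fun l _ => hterm l
  -- rewrite both sides through the factorisation (`Q := Σ_{x,w} [mono]`)
  have hmono_side : ∑ x, ∑ w, (∑ l, a l x * b l w) * TriDegTwo.monoInd x w =
      (3 - ε) * ∑ x : Fin 3 → Fin t → ZMod 2, ∑ w : Fin t × Fin t × Fin t, TriDegTwo.monoInd x w := by
    rw [Finset.mul_sum]; refine Finset.sum_congr rfl fun x _ => ?_
    rw [Finset.mul_sum]; refine Finset.sum_congr rfl fun w _ => ?_
    rw [← hfact x w]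
    simp only [TriDegTwo.monoInd]
    split_ifs <;> ring
  have hC : ∀ w : Fin t × Fin t × Fin t, ∑ _x : Fin 3 → Fin t → ZMod 2, (1 : ℝ) = 4 * ∑ x, TriDegTwo.monoInd x w := by
    intro w; rw [TriDegTwo.four_sum_monoInd w]; simp
  have hones : ∑ _x : Fin 3 → Fin t → ZMod 2, ∑ _w : Fin t × Fin t × Fin t, (1 : ℝ) =
      4 * ∑ x : Fin 3 → Fin t → ZMod 2, ∑ w : Fin t × Fin t × Fin t, TriDegTwo.monoInd x w := by
    have h1 : ∑ _x : Fin 3 → Fin t → ZMod 2, ∑ _w : Fin t × Fin t × Fin t, (1 : ℝ) =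
        (Fintype.card (Fin 3 → Fin t → ZMod 2) : ℝ) * Fintype.card (Fin t × Fin t × Fin t) := by
      simp only [Finset.sum_const, Finset.card_univ, nsmul_eq_mul, mul_one]
    have h2 : 4 * ∑ x : Fin 3 → Fin t → ZMod 2, ∑ w : Fin t × Fin t × Fin t, TriDegTwo.monoInd x w =
        (Fintype.card (Fin t × Fin t × Fin t) : ℝ) * Fintype.card (Fin 3 → Fin t → ZMod 2) := by
      rw [Finset.sum_comm, Finset.mul_sum]
      simp only [← hC, Finset.sum_const, Finset.card_univ, nsmul_eq_mul, mul_one]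
    rw [h1, h2]; ring
  have hmass_side : ∑ x, ∑ w, ∑ l, a l x * b l w =
      (1 - ε) * (4 * ∑ x : Fin 3 → Fin t → ZMod 2, ∑ w : Fin t × Fin t × Fin t, TriDegTwo.monoInd x w)
        + 2 * ∑ x : Fin 3 → Fin t → ZMod 2, ∑ w : Fin t × Fin t × Fin t, TriDegTwo.monoInd x w := by
    have : ∀ x w, ∑ l, a l x * b l w = (1 - ε) * 1 + 2 * TriDegTwo.monoInd x w := by
      intro x w; rw [← hfact x w]; simp only [TriDegTwo.monoInd]; split_ifs <;> ring
    simp only [this, Finset.sum_add_distrib, ← Finset.mul_sum, hones]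
  rw [hmono_side, hmass_side] at hsum
  -- `Q > 0` (the all-zero table is mono at every pointer triple, and there is one since `t ≥ 1`)
  have hQpos : 0 < ∑ x : Fin 3 → Fin t → ZMod 2, ∑ w : Fin t × Fin t × Fin t, TriDegTwo.monoInd x w := by
    obtain ⟨s, rfl⟩ : ∃ s, t = s + 1 := ⟨t - 1, by omega⟩
    have hmnn : ∀ (x : Fin 3 → Fin (s + 1) → ZMod 2) (w : Fin (s + 1) × Fin (s + 1) × Fin (s + 1)),
        0 ≤ TriDegTwo.monoInd x w := fun x w => by
      simp only [TriDegTwo.monoInd]; split_ifs <;> norm_num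
    have h1 : TriDegTwo.monoInd (fun (_ : Fin 3) (_ : Fin (s + 1)) => (0 : ZMod 2))
        ((0 : Fin (s + 1)), (0 : Fin (s + 1)), (0 : Fin (s + 1))) = 1 := by
      simp [TriDegTwo.monoInd]
    have hle1 : (1 : ℝ) ≤ ∑ w : Fin (s + 1) × Fin (s + 1) × Fin (s + 1),
        TriDegTwo.monoInd (fun (_ : Fin 3) (_ : Fin (s + 1)) => (0 : ZMod 2)) w := by
      rw [← h1]
      exact Finset.single_le_sum (fun w _ => hmnn _ w) (Finset.mem_univ _)
    have hle2 : ∑ w : Fin (s + 1) × Fin (s + 1) × Fin (s + 1),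
        TriDegTwo.monoInd (fun (_ : Fin 3) (_ : Fin (s + 1)) => (0 : ZMod 2)) w ≤
        ∑ x : Fin 3 → Fin (s + 1) → ZMod 2, ∑ w : Fin (s + 1) × Fin (s + 1) × Fin (s + 1),
          TriDegTwo.monoInd x w :=
      Finset.single_le_sum (f := fun x : Fin 3 → Fin (s + 1) → ZMod 2 =>
          ∑ w : Fin (s + 1) × Fin (s + 1) × Fin (s + 1), TriDegTwo.monoInd x w)
        (fun x _ => Finset.sum_nonneg fun w _ => hmnn x w) (Finset.mem_univ _)
    linarith
  nlinarith [hsum, hQpos]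

end

end Summit.PneNP.PneNP.Theorems.XorDoor
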